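import Summits.Ventures.PercRepro.S2ContractionCount

/-!
# PercRepro — S2: THE TOP `7`-SETS THROUGH `W`, THE REFINED CLASSES OF THE CONTRACTION LEVER (p7, gen 14; sub-claim S2; the case `ν = 4` of `(14, 7)`)

For the top `7`-sets (`ρ(B) = 5`, `E ∖ B` spanning, `|B ∩ W| ≥ 4`) the crude count of S2ContractionCount charges every outside part by the
`N`-dependent sets of `N := M ／ W`; the refined classes apply the lever `S2.contract_dep_sdiff_of_dep_of_indep_inter` to a BASIS `J` of `B ∩ W`
(`ρ(J ∪ (B ∖ W)) = ρ(B) = 5 < |J| + |B ∖ W|` once `|J| + |B ∖ W| ≥ 6`) and, for an independent `B ∩ W` of `4` points, to `(B ∩ W) ∪ P` for every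
pair `P ⊆ B ∖ W`: **`ncard_top_seven_le_contract`** —
  `#{top 7-sets} ≤ I₄(W)·#{3-sets all of whose pairs are N-dependent} + R₄³(W)·D₃(N) + R₄²(W)·C(|E ∖ W|, 3) + R₅⁴(W)·D₂(N) + R₅³(W)·C(|E ∖ W|, 2)
   + C(|W|, 6)·|E ∖ W| + C(|W|, 7)`
(`R₄³` = the `4`-subsets of rank `3`, `R₄²` those of rank `≤ 2`, `R₅⁴` the `5`-subsets of rank `≥ 4`, `R₅³` those of rank `≤ 3`). At `(14, 7)`, `ν = 4`
(`W` a `9`-point flat, `N` of nullity `3` on `12` points): `≤ I₄·20 + R₄³·70 + 0 + R₅⁴·6 + R₅³·66 + 1008 + 36`. Axioms: standard.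
-/

open scoped Matroid

namespace PercRepro

namespace S2

open Set

variable {α : Type}

/-- **The top `7`-sets through `W`, refined** (see the module docstring). -/
theorem ncard_top_seven_le_contract (M : Matroid α) [M.Finite] {W : Set α} (hW : W ⊆ M.E)
    (hhit : ∀ B, B ⊆ M.E → B.ncard = 7 → M.eRk B = 5 → M.eRk (M.E \ B) = M.eRank → 4 ≤ (B ∩ W).ncard) :
    {B : Set α | B ⊆ M.E ∧ B.ncard = 7 ∧ M.eRk B = 5 ∧ M.eRk (M.E \ B) = M.eRank}.ncard ≤
      {T : Set α | T ⊆ W ∧ T.ncard = 4 ∧ M.Indep T}.ncard *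
          {X : Set α | X ⊆ M.E \ W ∧ X.ncard = 3 ∧ ∀ x ∈ X, ∀ y ∈ X, x ≠ y → (M ／ W).Dep {x, y}}.ncard +
        {T : Set α | T ⊆ W ∧ T.ncard = 4 ∧ M.eRk T = 3}.ncard *
          {X : Set α | X ⊆ M.E \ W ∧ X.ncard = 3 ∧ (M ／ W).Dep X}.ncard +
        {T : Set α | T ⊆ W ∧ T.ncard = 4 ∧ M.eRk T ≤ 2}.ncard * (M.E \ W).ncard.choose 3 +
        {T : Set α | T ⊆ W ∧ T.ncard = 5 ∧ 4 ≤ M.eRk T}.ncard *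
          {X : Set α | X ⊆ M.E \ W ∧ X.ncard = 2 ∧ (M ／ W).Dep X}.ncard +
        {T : Set α | T ⊆ W ∧ T.ncard = 5 ∧ M.eRk T ≤ 3}.ncard * (M.E \ W).ncard.choose 2 +
        W.ncard.choose 6 * (M.E \ W).ncard + W.ncard.choose 7 := by
  classical
  set Top := {B : Set α | B ⊆ M.E ∧ B.ncard = 7 ∧ M.eRk B = 5 ∧ M.eRk (M.E \ B) = M.eRank} with hTop
  have hWfin : W.Finite := M.ground_finite.subset hW
  have hRfin : (M.E \ W).Finite := M.ground_finite.sdiff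
  have hTopfin : Top.Finite := M.ground_finite.finite_subsets.subset (fun B hB => hB.1)
  have hPWfin : ∀ k, {T : Set α | T ⊆ W ∧ T.ncard = k}.Finite := fun k => hWfin.finite_subsets.subset (fun T hT => hT.1)
  have hPRfin : ∀ k, {X : Set α | X ⊆ M.E \ W ∧ X.ncard = k}.Finite := fun k => hRfin.finite_subsets.subset (fun X hX => hX.1)
  -- the split of a member of `Top`
  have hsplit : ∀ B ∈ Top, (B ∩ W).ncard + (B \ W).ncard = 7 := by
    rintro B ⟨hBE, hB7, -, -⟩
    rw [← hB7]
    exact Set.ncard_inter_add_ncard_sdiff_eq_ncard B W (M.ground_finite.subset hBE)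
  have hdep : ∀ B ∈ Top, M.Dep B := by
    rintro B ⟨hBE, hB7, hB5, -⟩
    have hBfin : B.Finite := M.ground_finite.subset hBE
    rw [← Matroid.eRk_lt_encard_iff_dep_of_finite hBfin hBE, hB5, ← hBfin.cast_ncard_eq, hB7]
    norm_num
  -- the lever on a basis `J` of `B ∩ W`: `ρ(J ∪ (B ∖ W)) = ρ(B) = 5`, dependent once `|J| + |B ∖ W| ≥ 6`
  have hkey : ∀ B ∈ Top, ∀ J : Set α, M.IsBasis J (B ∩ W) → 5 < J.ncard + (B \ W).ncard → (M ／ W).Dep (B \ W) := by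
    rintro B ⟨hBE, hB7, hB5, hBs⟩ J hJ hcard
    have hBfin : B.Finite := M.ground_finite.subset hBE
    have hJW : J ⊆ W := hJ.subset.trans Set.inter_subset_right
    have hJfin : J.Finite := hWfin.subset hJW
    set B'' := J ∪ (B \ W) with hB''
    have hB''E : B'' ⊆ M.E := Set.union_subset (hJW.trans hW) (sdiff_subset.trans hBE)
    have hB''fin : B''.Finite := hJfin.union hBfin.sdiff
    -- `ρ(B'') = ρ(B)`
    have hr1 : M.eRk B'' ≤ M.eRk B := M.eRk_mono (Set.union_subset (hJ.subset.trans Set.inter_subset_left) sdiff_subset)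
    have hr2 : M.eRk B ≤ M.eRk B'' := by
      have h1 : B ⊆ M.closure J ∪ (B \ W) := by
        intro x hx
        by_cases hxW : x ∈ W
        · exact Or.inl (hJ.subset_closure ⟨hx, hxW⟩)
        · exact Or.inr ⟨hx, hxW⟩
      calc M.eRk B ≤ M.eRk (M.closure J ∪ (B \ W)) := M.eRk_mono h1
        _ = M.eRk (J ∪ (B \ W)) := M.eRk_union_closure_left_eq J (B \ W)
    have hB''dep : M.Dep B'' := by
      rw [← Matroid.eRk_lt_encard_iff_dep_of_finite hB''fin hB''E]
      have hc : B''.encard = ((J.ncard + (B \ W).ncard : ℕ) : ℕ∞) := by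
        rw [hB'', Set.encard_union_eq (Set.disjoint_left.2 (fun x hxJ hxB => hxB.2 (hJW hxJ))),
          ← hJfin.cast_ncard_eq, ← hBfin.sdiff.cast_ncard_eq]
        push_cast
        ring
      rw [hc]
      calc M.eRk B'' ≤ M.eRk B := hr1
        _ = 5 := hB5
        _ < ((J.ncard + (B \ W).ncard : ℕ) : ℕ∞) := by exact_mod_cast hcard
    have hinter : B'' ∩ W = J := by
      ext x
      constructor
      · rintro ⟨hx, hxW⟩
        rcases hx with hxJ | hxB
        · exact hxJ
        · exact absurd hxW hxB.2
      · intro hxJ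
        exact ⟨Or.inl hxJ, hJW hxJ⟩
    have hsd : B'' \ W = B \ W := by
      ext x
      constructor
      · rintro ⟨hx, hxW⟩
        rcases hx with hxJ | hxB
        · exact absurd (hJW hxJ) hxW
        · exact hxB
      · intro hx
        exact ⟨Or.inr hx, hx.2⟩
    have := contract_dep_sdiff_of_dep_of_indep_inter M hW hB''E hB''dep (hinter ▸ hJ.indep)
    rwa [hsd] at this
  -- the classes
  let A1 : Set (Set α) := {B ∈ Top | (B ∩ W).ncard = 4 ∧ M.Indep (B ∩ W)}
  let A2 : Set (Set α) := {B ∈ Top | (B ∩ W).ncard = 4 ∧ M.eRk (B ∩ W) = 3}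
  let A3 : Set (Set α) := {B ∈ Top | (B ∩ W).ncard = 4 ∧ M.eRk (B ∩ W) ≤ 2}
  let A4 : Set (Set α) := {B ∈ Top | (B ∩ W).ncard = 5 ∧ 4 ≤ M.eRk (B ∩ W)}
  let A5 : Set (Set α) := {B ∈ Top | (B ∩ W).ncard = 5 ∧ M.eRk (B ∩ W) ≤ 3}
  let A6 : Set (Set α) := {B ∈ Top | (B ∩ W).ncard = 6}
  let A7 : Set (Set α) := {B ∈ Top | (B ∩ W).ncard = 7}
  have hcover : Top ⊆ A1 ∪ A2 ∪ A3 ∪ A4 ∪ A5 ∪ A6 ∪ A7 := by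
    intro B hB
    have hB' := hB
    obtain ⟨hBE, hB7, hB5, hBs⟩ := hB'
    have hBfin : B.Finite := M.ground_finite.subset hBE
    have hj1 : 4 ≤ (B ∩ W).ncard := hhit B hBE hB7 hB5 hBs
    have hj2 : (B ∩ W).ncard ≤ 7 := hB7 ▸ Set.ncard_le_ncard Set.inter_subset_left hBfin
    have hTE : B ∩ W ⊆ M.E := Set.inter_subset_left.trans hBE
    have hTfin : (B ∩ W).Finite := hBfin.inter_of_left W
    rcases (show (B ∩ W).ncard = 4 ∨ (B ∩ W).ncard = 5 ∨ (B ∩ W).ncard = 6 ∨ (B ∩ W).ncard = 7 by omega) with h4 | h5 | h6 | h7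
    · by_cases hind : M.Indep (B ∩ W)
      · exact Or.inl (Or.inl (Or.inl (Or.inl (Or.inl (Or.inl ⟨hB, h4, hind⟩)))))
      · have hlt : M.eRk (B ∩ W) < 4 := by
          have := (Matroid.eRk_lt_encard_iff_dep_of_finite hTfin hTE).2 (M.dep_iff.2 ⟨hind, hTE⟩)
          rwa [← hTfin.cast_ncard_eq, h4] at this
        have hle : M.eRk (B ∩ W) ≤ 3 := by
          have h : M.eRk (B ∩ W) < (3 : ℕ∞) + 1 := by
            rw [show (3 : ℕ∞) + 1 = 4 by norm_num]
            exact hlt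
          exact Order.le_of_lt_add_one h
        rcases (show M.eRk (B ∩ W) = 3 ∨ M.eRk (B ∩ W) ≤ 2 by
          rcases eq_or_lt_of_le hle with h | h
          · exact Or.inl h
          · refine Or.inr (Order.le_of_lt_add_one ?_)
            rw [show (2 : ℕ∞) + 1 = 3 by norm_num]
            exact h) with h3 | h2
        · exact Or.inl (Or.inl (Or.inl (Or.inl (Or.inl (Or.inr ⟨hB, h4, h3⟩)))))
        · exact Or.inl (Or.inl (Or.inl (Or.inl (Or.inr ⟨hB, h4, h2⟩))))
    · by_cases hr : 4 ≤ M.eRk (B ∩ W)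
      · exact Or.inl (Or.inl (Or.inl (Or.inr ⟨hB, h5, hr⟩)))
      · push Not at hr
        have hr' : M.eRk (B ∩ W) ≤ 3 := by
          have h : M.eRk (B ∩ W) < (3 : ℕ∞) + 1 := by
            rw [show (3 : ℕ∞) + 1 = 4 by norm_num]
            exact hr
          exact Order.le_of_lt_add_one h
        exact Or.inl (Or.inl (Or.inr ⟨hB, h5, hr'⟩))
    · exact Or.inl (Or.inr ⟨hB, h6⟩)
    · exact Or.inr ⟨hB, h7⟩
  -- the injections `B ↦ (B ∩ W, B ∖ W)`
  have hinj : Set.InjOn (fun B : Set α => (B ∩ W, B \ W)) Top := by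
    rintro B₁ - B₂ - hEq
    simp only [Prod.mk.injEq] at hEq
    rw [← Set.inter_union_sdiff B₁ W, ← Set.inter_union_sdiff B₂ W, hEq.1, hEq.2]
  have hsubTop : ∀ {S : Set (Set α)}, S ⊆ Top → Set.InjOn (fun B : Set α => (B ∩ W, B \ W)) S :=
    fun hS => hinj.mono hS
  -- A1: the pairs of `B ∖ W` are `N`-dependent
  have hA1 : A1.ncard ≤ {T : Set α | T ⊆ W ∧ T.ncard = 4 ∧ M.Indep T}.ncard *
      {X : Set α | X ⊆ M.E \ W ∧ X.ncard = 3 ∧ ∀ x ∈ X, ∀ y ∈ X, x ≠ y → (M ／ W).Dep {x, y}}.ncard := by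
    rw [← Set.ncard_prod]
    refine Set.ncard_le_ncard_of_injOn _ ?_ (hsubTop (fun B hB => hB.1))
      (((hPWfin 4).subset (fun T hT => ⟨hT.1, hT.2.1⟩)).prod ((hPRfin 3).subset (fun X hX => ⟨hX.1, hX.2.1⟩)))
    rintro B ⟨hB, h4, hind⟩
    have hBE : B ⊆ M.E := hB.1
    have hs := hsplit B hB
    refine Set.mem_prod.2 ⟨⟨Set.inter_subset_right, h4, hind⟩, ⟨sdiff_subset_sdiff_left hBE, ?_, ?_⟩⟩
    · show (B \ W).ncard = 3
      omega
    · intro x hx y hy hxy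
      -- `B' = (B ∩ W) ∪ {x, y}` is a dependent `6`-set with `B' ∩ W = B ∩ W`
      set B' := (B ∩ W) ∪ {x, y} with hB'
      have hxW : x ∉ W := hx.2
      have hyW : y ∉ W := hy.2
      have hB'E : B' ⊆ M.E := Set.union_subset (Set.inter_subset_left.trans hBE) (Set.pair_subset (hBE hx.1) (hBE hy.1))
      have hB'B : B' ⊆ B := Set.union_subset Set.inter_subset_left (Set.pair_subset hx.1 hy.1)
      have hB'fin : B'.Finite := (M.ground_finite.subset hBE).subset hB'B
      have hB'card : B'.ncard = 6 := by
        rw [hB', Set.ncard_union_eq (Set.disjoint_left.2 (fun z hz hzp => by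
            rcases hzp with rfl | rfl
            · exact hxW hz.2
            · exact hyW hz.2)) ((M.ground_finite.subset hBE).inter_of_left W) (Set.toFinite _), h4, Set.ncard_pair hxy]
      have hB'dep : M.Dep B' := by
        rw [← Matroid.eRk_lt_encard_iff_dep_of_finite hB'fin hB'E, ← hB'fin.cast_ncard_eq, hB'card]
        calc M.eRk B' ≤ M.eRk B := M.eRk_mono hB'B
          _ = 5 := hB.2.2.1
          _ < ((6 : ℕ) : ℕ∞) := by norm_num
      have hinter : B' ∩ W = B ∩ W := by
        ext z
        constructor
        · rintro ⟨hz, hzW⟩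
          rcases hz with hzB | hzp
          · exact hzB
          · rcases hzp with rfl | rfl
            · exact absurd hzW hxW
            · exact absurd hzW hyW
        · intro hz
          exact ⟨Or.inl hz, hz.2⟩
      have hsd : B' \ W = {x, y} := by
        ext z
        constructor
        · rintro ⟨hz, hzW⟩
          rcases hz with hzB | hzp
          · exact absurd hzB.2 hzW
          · exact hzp
        · intro hz
          refine ⟨Or.inr hz, ?_⟩
          rcases hz with rfl | rfl
          · exact hxW
          · exact hyW
      have := contract_dep_sdiff_of_dep_of_indep_inter M hW hB'E hB'dep (hinter ▸ hind)
      rwa [hsd] at this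
  -- A2: a basis of `3` points of `B ∩ W`
  have hA2 : A2.ncard ≤ {T : Set α | T ⊆ W ∧ T.ncard = 4 ∧ M.eRk T = 3}.ncard *
      {X : Set α | X ⊆ M.E \ W ∧ X.ncard = 3 ∧ (M ／ W).Dep X}.ncard := by
    rw [← Set.ncard_prod]
    refine Set.ncard_le_ncard_of_injOn _ ?_ (hsubTop (fun B hB => hB.1))
      (((hPWfin 4).subset (fun T hT => ⟨hT.1, hT.2.1⟩)).prod ((hPRfin 3).subset (fun X hX => ⟨hX.1, hX.2.1⟩)))
    rintro B ⟨hB, h4, hr3⟩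
    have hs := hsplit B hB
    have hTE : B ∩ W ⊆ M.E := Set.inter_subset_left.trans hB.1
    obtain ⟨J, hJ⟩ := M.exists_isBasis (B ∩ W) hTE
    have hJc : J.ncard = 3 := by
      have h := hJ.encard_eq_eRk
      rw [hr3, ← (hWfin.subset (hJ.subset.trans Set.inter_subset_right)).cast_ncard_eq] at h
      exact_mod_cast h
    refine Set.mem_prod.2 ⟨⟨Set.inter_subset_right, h4, hr3⟩, ⟨sdiff_subset_sdiff_left hB.1, ?_, hkey B hB J hJ (by omega)⟩⟩
    show (B \ W).ncard = 3
    omega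
  -- A3: rank `≤ 2`, the crude count
  have hA3 : A3.ncard ≤ {T : Set α | T ⊆ W ∧ T.ncard = 4 ∧ M.eRk T ≤ 2}.ncard * (M.E \ W).ncard.choose 3 := by
    rw [← ncard_subsets_ncard_eq (M.E \ W) hRfin 3, ← Set.ncard_prod]
    refine Set.ncard_le_ncard_of_injOn _ ?_ (hsubTop (fun B hB => hB.1))
      (((hPWfin 4).subset (fun T hT => ⟨hT.1, hT.2.1⟩)).prod (hPRfin 3))
    rintro B ⟨hB, h4, hr⟩
    have hs := hsplit B hB
    refine Set.mem_prod.2 ⟨⟨Set.inter_subset_right, h4, hr⟩, ⟨sdiff_subset_sdiff_left hB.1, ?_⟩⟩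
    show (B \ W).ncard = 3
    omega
  -- A4: a basis of `≥ 4` points of `B ∩ W`
  have hA4 : A4.ncard ≤ {T : Set α | T ⊆ W ∧ T.ncard = 5 ∧ 4 ≤ M.eRk T}.ncard *
      {X : Set α | X ⊆ M.E \ W ∧ X.ncard = 2 ∧ (M ／ W).Dep X}.ncard := by
    rw [← Set.ncard_prod]
    refine Set.ncard_le_ncard_of_injOn _ ?_ (hsubTop (fun B hB => hB.1))
      (((hPWfin 5).subset (fun T hT => ⟨hT.1, hT.2.1⟩)).prod ((hPRfin 2).subset (fun X hX => ⟨hX.1, hX.2.1⟩)))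
    rintro B ⟨hB, h5, hr⟩
    have hs := hsplit B hB
    have hTE : B ∩ W ⊆ M.E := Set.inter_subset_left.trans hB.1
    obtain ⟨J, hJ⟩ := M.exists_isBasis (B ∩ W) hTE
    have hJc : 4 ≤ J.ncard := by
      have h := hJ.encard_eq_eRk
      rw [← (hWfin.subset (hJ.subset.trans Set.inter_subset_right)).cast_ncard_eq] at h
      have : ((4 : ℕ) : ℕ∞) ≤ ((J.ncard : ℕ) : ℕ∞) := by rw [h]; exact_mod_cast hr
      exact_mod_cast this
    refine Set.mem_prod.2 ⟨⟨Set.inter_subset_right, h5, hr⟩, ⟨sdiff_subset_sdiff_left hB.1, ?_, hkey B hB J hJ (by omega)⟩⟩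
    show (B \ W).ncard = 2
    omega
  -- A5: rank `≤ 3`, the crude count
  have hA5 : A5.ncard ≤ {T : Set α | T ⊆ W ∧ T.ncard = 5 ∧ M.eRk T ≤ 3}.ncard * (M.E \ W).ncard.choose 2 := by
    rw [← ncard_subsets_ncard_eq (M.E \ W) hRfin 2, ← Set.ncard_prod]
    refine Set.ncard_le_ncard_of_injOn _ ?_ (hsubTop (fun B hB => hB.1))
      (((hPWfin 5).subset (fun T hT => ⟨hT.1, hT.2.1⟩)).prod (hPRfin 2))
    rintro B ⟨hB, h5, hr⟩
    have hs := hsplit B hB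
    refine Set.mem_prod.2 ⟨⟨Set.inter_subset_right, h5, hr⟩, ⟨sdiff_subset_sdiff_left hB.1, ?_⟩⟩
    show (B \ W).ncard = 2
    omega
  -- A6: six points inside, one outside
  have hA6 : A6.ncard ≤ W.ncard.choose 6 * (M.E \ W).ncard := by
    have h1 : (M.E \ W).ncard = (M.E \ W).ncard.choose 1 := (Nat.choose_one_right _).symm
    rw [h1, ← ncard_subsets_ncard_eq W hWfin 6, ← ncard_subsets_ncard_eq (M.E \ W) hRfin 1, ← Set.ncard_prod]
    refine Set.ncard_le_ncard_of_injOn _ ?_ (hsubTop (fun B hB => hB.1)) ((hPWfin 6).prod (hPRfin 1))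
    rintro B ⟨hB, h6⟩
    have hs := hsplit B hB
    refine Set.mem_prod.2 ⟨⟨Set.inter_subset_right, h6⟩, ⟨sdiff_subset_sdiff_left hB.1, ?_⟩⟩
    show (B \ W).ncard = 1
    omega
  -- A7: inside `W`
  have hA7 : A7.ncard ≤ W.ncard.choose 7 := by
    rw [← ncard_subsets_ncard_eq W hWfin 7]
    refine Set.ncard_le_ncard ?_ (hPWfin 7)
    rintro B ⟨hB, h7⟩
    have hs := hsplit B hB
    have hBW : B ⊆ W := by
      have h0 : (B \ W).ncard = 0 := by omega
      rw [Set.ncard_eq_zero (M.ground_finite.subset hB.1).sdiff] at h0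
      exact Set.sdiff_eq_empty.1 h0
    exact ⟨hBW, hB.2.1⟩
  have hAfin : ∀ {S : Set (Set α)}, S ⊆ Top → S.Finite := fun hS => hTopfin.subset hS
  have hu := Set.ncard_le_ncard hcover ((((((hAfin (fun B hB => hB.1)).union (hAfin (fun B hB => hB.1))).union
    (hAfin (fun B hB => hB.1))).union (hAfin (fun B hB => hB.1))).union (hAfin (fun B hB => hB.1))).union
    (hAfin (fun B hB => hB.1)) |>.union (hAfin (fun B hB => hB.1)))
  have hu1 := Set.ncard_union_le (A1 ∪ A2 ∪ A3 ∪ A4 ∪ A5 ∪ A6) A7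
  have hu2 := Set.ncard_union_le (A1 ∪ A2 ∪ A3 ∪ A4 ∪ A5) A6
  have hu3 := Set.ncard_union_le (A1 ∪ A2 ∪ A3 ∪ A4) A5
  have hu4 := Set.ncard_union_le (A1 ∪ A2 ∪ A3) A4
  have hu5 := Set.ncard_union_le (A1 ∪ A2) A3
  have hu6 := Set.ncard_union_le A1 A2
  omega

end S2

end PercRepro
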